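import Mathlib.MeasureTheory.Integral.Bochner.ContinuousLinearMap
import Mathlib.MeasureTheory.Function.L2Space
import Mathlib.MeasureTheory.Group.Integral
import Mathlib.RepresentationTheory.Irreducible
import Literature.NumberTheory.Automorphic.UnitaryAdmissibleCompleteReducibility   -- ★ `exists_isCompl_subrepresentation_of_invariant_form`
import Literature.NumberTheory.Automorphic.CompactOpenAveraging                    -- ★ `avgProjLinear`, `comp_avgProjLinear_mem_contragredient`, `avgProj_of_forall_apply_eq`
import Literature.NumberTheory.Automorphic.MatrixCoefficients                      -- ★ `Representation.matrixCoeff`, `IsUnitarizable`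
import HarnessLib

/-!
# Square-integrable matrix coefficients give an invariant positive form; self-extensions of an irreducible with `L²` coefficients split

Topic `NumberTheory/Automorphic`; namespace `Literature.NumberTheory.Automorphic` (dot-lemmas on Mathlib's `Representation`).  THEOREMS ONLY: no definition, no named fact,
no instance, no notation, no `sorry`.  Cell `pub/hodgecm-mathlib`, crux H413 (`--supports stmt-HodgeConjecture-24833`), E1 BRICK LEDGER row 70 (keeper F0P3a-p03 (g31) k11∕k16):
the generic (S2)+(S3) layer of MEMO «K2′ `hsplit` for an `L²` class via Casselman's criterion + the unitarity trick» (F0P2-p06 (g23), d721df4f); the `L²`-ness of the representation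
carrying the form is a HYPOTHESIS ((S1) [Casselman1995 Thm. 4.4.6] is NOT used).  `G` a topological group, `μ` a right-invariant measure charging open sets, `ρ` a representation
on a complex vector space `V`, `c_{φ,v}(g) = φ(ρ(g) v)` (★ `Representation.matrixCoeff`).
* §1 **`L²` COEFFICIENTS ⇒ AN INVARIANT POSITIVE-DEFINITE HERMITIAN FORM** `⟨v, w⟩ := Σᵢ ∫_G conj(c_{φᵢ,v}) c_{φᵢ,w} dμ` for finitely many `φᵢ` with `L²` coefficients:
  sesquilinear, Hermitian, `≥ 0`, `G`-invariant (`c_{φ,ρ(h)v}(g) = c_{φ,v}(g h)`, right invariance), DEFINITE when no `v ≠ 0` has all `c_{φᵢ,v}` a.e. zero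
  (`exists_invariant_form_of_memLp_matrixCoeff` — the six conjuncts ARE the six hypotheses of ★ `exists_isCompl_subrepresentation_of_invariant_form`, in its order); for SMOOTH `ρ`,
  `c_{φ,v}(g₀) ≠ 0 ⇒ c_{φ,v}` is not a.e. zero (constant on the open coset `g₀ · Stab(v)`, `not_matrixCoeff_ae_eq_zero`); packaged `isUnitarizable_of_memLp_matrixCoeff`.
* §2 **COMPLETE REDUCIBILITY** for `ρ` admissible, `G` with a compact open subgroup (`exists_isCompl_of_memLp_matrixCoeff`, ★ `UnitaryAdmissibleCompleteReducibility`).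
* §3 **SECTIONS FROM COMPLEMENTS** (pure algebra): `0 → σ —i→ τ —p→ σ'` exact in the middle, `p` surjective, `W'` an invariant complement of `i.range` ⇒ an equivariant section of `p`
  (`exists_section_of_isCompl_range`).
* §4 **SELF-EXTENSIONS OF AN IRREDUCIBLE WITH `L²` COEFFICIENTS SPLIT** (`selfExtension_splits_of_memLp_matrixCoeff`): `σ`, `σ'` irreducible, `τ` ADMISSIBLE with every SMOOTH
  coefficient (`φ ∈ τ̃`) in `L²(μ)`, `0 → σ —i→ τ —p→ σ' → 0` exact ⇒ `p` has an equivariant section.  ONE smooth functional `φ = l ∘ e_K ∈ τ̃` non-zero on `i(σ)` (★ `avgProjLinear`);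
  the largest subrepresentation `N` in `ker φ` meets `i(σ)` trivially; either `p(N) = ⊤` (`N` is an invariant complement of `ker p`) or `N = ⊥` (the one family `c_{φ,·}` separates,
  §1–§2 give the complement); §3.  In the cell: `hsplit` of ★ `Theorems/F0P3cStCharTSEPNormOneUnr` at an `L²` class, modulo «self-extensions of `L²` irreducibles are `L²`».
HC_CM is proved only modulo the printed citations until rung 0 closes; this file is generic representation theory and discharges no named fact.

## References
* [BernsteinZelevinskyRMS1976] I. N. Bernstein, A. V. Zelevinsky, Russian Math. Surveys 31:3 (1976), §2.1–§2.3; 2.39–2.44 pp. 26–28 (matrix elements; finite representations split off); 4.1 Theorem pp. 37–38.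
* [BushnellHenniart2006] C. J. Bushnell, G. Henniart, *The local Langlands conjecture for GL(2)* (2006), §2.8, §10.1 p. 70, 10a.1–10a.2 pp. 73–75 (coefficients; the inner product `∫ c c̄`; square-integrable mod `Z`).
* [Casselman1995] W. Casselman, *Introduction to the theory of admissible representations of `p`-adic reductive groups* (1995), Prop. 2.1.5 p. 20, §2.5 Prop. 2.5.3–2.5.4 p. 29, Thm. 4.4.6.
-/

set_option autoImplicit false

noncomputable section

open MeasureTheory
open scoped ComplexConjugate ENNReal

namespace Literature.NumberTheory.Automorphic

/-! ## §1 The form `⟨v, w⟩ = Σᵢ ∫ conj(c_{φᵢ,v}) c_{φᵢ,w}` -/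

section Algebra

variable {G : Type*} [Group G] {V : Type*} [AddCommGroup V] [Module ℂ V] (ρ : Representation ℂ G V)

/-- translation of the vector = right translation of the coefficient: `c_{φ, ρ(h) v}(g) = c_{φ,v}(g h)`. [cite: BushnellHenniart2006, §10.1] -/
theorem _root_.Representation.matrixCoeff_apply_right (φ : Module.Dual ℂ V) (v : V) (h g : G) :
    ρ.matrixCoeff φ (ρ h v) g = ρ.matrixCoeff φ v (g * h) := by
  simp only [Representation.matrixCoeff_apply, map_mul, Module.End.mul_apply]

/-- the coefficient is additive in the vector, pointwise. [cite: BushnellHenniart2006, §10.1] -/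
theorem _root_.Representation.matrixCoeff_add_right_apply (φ : Module.Dual ℂ V) (v w : V) (g : G) :
    ρ.matrixCoeff φ (v + w) g = ρ.matrixCoeff φ v g + ρ.matrixCoeff φ w g := by
  simp only [Representation.matrixCoeff_apply, map_add]

/-- the coefficient is homogeneous in the vector, pointwise. [cite: BushnellHenniart2006, §10.1] -/
theorem _root_.Representation.matrixCoeff_smul_right_apply (φ : Module.Dual ℂ V) (a : ℂ) (v : V) (g : G) :
    ρ.matrixCoeff φ (a • v) g = a * ρ.matrixCoeff φ v g := by
  simp only [Representation.matrixCoeff_apply, map_smul, smul_eq_mul]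

variable [MeasurableSpace G] (μ : Measure G)

/-- Hölder `(2, 2)`: the product `conj(c_{φ,v}) · c_{φ,w}` of two `L²` coefficients is integrable. [cite: BushnellHenniart2006, §10.1 p. 70; 10a.1–10a.2 pp. 73–75] -/
theorem _root_.Representation.integrable_conj_matrixCoeff_mul {φ : Module.Dual ℂ V} {v w : V}
    (hv : MemLp (ρ.matrixCoeff φ v) 2 μ) (hw : MemLp (ρ.matrixCoeff φ w) 2 μ) :
    Integrable (fun g => conj (ρ.matrixCoeff φ v g) * ρ.matrixCoeff φ w g) μ := by
  have h := (hv.star).integrable_mul hw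
  refine h.congr (Filter.Eventually.of_forall fun g => ?_)
  simp only [Pi.mul_apply, Pi.star_apply, RCLike.star_def]

/-- the diagonal term is the integral of `‖c_{φ,v}‖²`, a real number `≥ 0`. [cite: BushnellHenniart2006, §10.1 p. 70; 10a.1–10a.2 pp. 73–75] -/
theorem _root_.Representation.integral_conj_matrixCoeff_mul_self {φ : Module.Dual ℂ V} {v : V} :
    ∫ g, conj (ρ.matrixCoeff φ v g) * ρ.matrixCoeff φ v g ∂μ = ((∫ g, ‖ρ.matrixCoeff φ v g‖ ^ 2 ∂μ : ℝ) : ℂ) := by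
  rw [← integral_complex_ofReal]
  refine integral_congr_ae (Filter.Eventually.of_forall fun g => ?_)
  show conj (ρ.matrixCoeff φ v g) * ρ.matrixCoeff φ v g = ((‖ρ.matrixCoeff φ v g‖ ^ 2 : ℝ) : ℂ)
  rw [RCLike.conj_mul]
  norm_cast

end Algebra

section Form

variable {G : Type*} [Group G] [TopologicalSpace G] [MeasurableSpace G] [BorelSpace G]
  (μ : Measure G) {V : Type*} [AddCommGroup V] [Module ℂ V] (ρ : Representation ℂ G V)

omit [BorelSpace G] in
/-- a matrix coefficient not vanishing at `g₀` is NOT a.e. zero, for a SMOOTH representation and a measure charging open sets: it equals `φ(ρ g₀ v) ≠ 0` on the open coset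
`g₀ · Stab(v)` (`c_{φ,v}(g₀ k) = φ(ρ g₀ (ρ k v)) = φ(ρ g₀ v)`). [cite: BernsteinZelevinskyRMS1976, §2.1] -/
theorem _root_.Representation.not_matrixCoeff_ae_eq_zero [IsTopologicalGroup G] [μ.IsOpenPosMeasure] (hρ : ρ.IsSmooth)
    {φ : Module.Dual ℂ V} {v : V} {g₀ : G} (h : φ (ρ g₀ v) ≠ 0) : ¬ (ρ.matrixCoeff φ v =ᵐ[μ] 0) := by
  intro hae
  set U : Set G := (fun k => g₀ * k) '' (ρ.stabilizerSubgroup v : Set G) with hU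
  have hUo : IsOpen U := (Homeomorph.mulLeft g₀).isOpenMap _ (hρ v)
  have hUne : U.Nonempty := ⟨g₀ * 1, 1, (ρ.stabilizerSubgroup v).one_mem, rfl⟩
  have hUsub : U ⊆ {g | ρ.matrixCoeff φ v g ≠ 0} := by
    rintro _ ⟨k, hk, rfl⟩
    have hk' : ρ k v = v := (Representation.mem_stabilizerSubgroup ρ v k).1 hk
    show φ (ρ (g₀ * k) v) ≠ 0
    rwa [map_mul, Module.End.mul_apply, hk']
  have hpos : 0 < μ U := hUo.measure_pos μ hUne
  have hzero : μ {g | ρ.matrixCoeff φ v g ≠ 0} = 0 := by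
    have := hae
    rw [Filter.EventuallyEq, ae_iff] at this
    simpa using this
  exact absurd (measure_mono_null hUsub hzero) hpos.ne'

variable [IsTopologicalGroup G]

/-- **`L²` COEFFICIENTS ⇒ A `G`-INVARIANT POSITIVE-DEFINITE HERMITIAN FORM.**  For a right-invariant measure `μ`, finitely many linear forms `φᵢ` with all coefficients
`c_{φᵢ,v} ∈ L²(μ)` and separating in the sense `v ≠ 0 ⇒ some c_{φᵢ,v} is not a.e. zero`, the form `⟨v, w⟩ := Σᵢ ∫ conj(c_{φᵢ,v}) c_{φᵢ,w} dμ` is additive and conjugate-linear in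
the first variable, Hermitian, non-negative, definite and `G`-invariant — the six hypotheses of ★ `exists_isCompl_subrepresentation_of_invariant_form`, in its order.
[cite: Casselman1995, §2.5 Prop. 2.5.3–2.5.4 p. 29] [cite: BushnellHenniart2006, §10.1 p. 70; 10a.1–10a.2 pp. 73–75] [cite: Casselman1995, §2.5] -/
theorem _root_.Representation.exists_invariant_form_of_memLp_matrixCoeff [μ.IsMulRightInvariant] {ι : Type*} [Fintype ι] (φ : ι → Module.Dual ℂ V)
    (hL2 : ∀ (i : ι) (v : V), MemLp (ρ.matrixCoeff (φ i) v) 2 μ)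
    (hsep : ∀ v : V, v ≠ 0 → ∃ i, ¬ (ρ.matrixCoeff (φ i) v =ᵐ[μ] 0)) :
    ∃ ip : V → V → ℂ, (∀ x y z, ip (x + y) z = ip x z + ip y z) ∧ (∀ (c : ℂ) (x y : V), ip (c • x) y = conj c * ip x y) ∧
      (∀ x y, conj (ip y x) = ip x y) ∧ (∀ x, 0 ≤ (ip x x).re) ∧ (∀ x, ip x x = 0 → x = 0) ∧ (∀ (g : G) (x y : V), ip (ρ g x) (ρ g y) = ip x y) := by
  refine ⟨fun v w => ∑ i, ∫ g, conj (ρ.matrixCoeff (φ i) v g) * ρ.matrixCoeff (φ i) w g ∂μ, ?_, ?_, ?_, ?_, ?_, ?_⟩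
  · -- additive in the first variable
    intro x y z
    rw [← Finset.sum_add_distrib]
    refine Finset.sum_congr rfl fun i _ => ?_
    rw [← integral_add (ρ.integrable_conj_matrixCoeff_mul μ (hL2 i x) (hL2 i z)) (ρ.integrable_conj_matrixCoeff_mul μ (hL2 i y) (hL2 i z))]
    refine integral_congr_ae (Filter.Eventually.of_forall fun g => ?_)
    simp only [Representation.matrixCoeff_add_right_apply, map_add, add_mul]
  · -- conjugate-linear in the first variable
    intro c x y
    rw [Finset.mul_sum]
    refine Finset.sum_congr rfl fun i _ => ?_
    rw [← integral_const_mul]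
    refine integral_congr_ae (Filter.Eventually.of_forall fun g => ?_)
    simp only [Representation.matrixCoeff_smul_right_apply, map_mul, mul_assoc]
  · -- Hermitian
    intro x y
    rw [map_sum]
    refine Finset.sum_congr rfl fun i _ => ?_
    rw [← integral_conj]
    refine integral_congr_ae (Filter.Eventually.of_forall fun g => ?_)
    simp only [map_mul, RingHomCompTriple.comp_apply, RingHom.id_apply, mul_comm]
  · -- non-negative
    intro x
    rw [Complex.re_sum]
    refine Finset.sum_nonneg fun i _ => ?_
    rw [ρ.integral_conj_matrixCoeff_mul_self μ, Complex.ofReal_re]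
    exact integral_nonneg fun g => sq_nonneg _
  · -- definite
    intro x hx
    by_contra hx0
    obtain ⟨i, hi⟩ := hsep x hx0
    simp only at hx
    have hre : (∑ j, ∫ g, conj (ρ.matrixCoeff (φ j) x g) * ρ.matrixCoeff (φ j) x g ∂μ).re = 0 := by rw [hx, Complex.zero_re]
    rw [Complex.re_sum] at hre
    have hterm : ∀ j ∈ (Finset.univ : Finset ι), 0 ≤ (∫ g, conj (ρ.matrixCoeff (φ j) x g) * ρ.matrixCoeff (φ j) x g ∂μ).re := fun j _ => by
      rw [ρ.integral_conj_matrixCoeff_mul_self μ, Complex.ofReal_re]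
      exact integral_nonneg fun g => sq_nonneg _
    have hi0 := (Finset.sum_eq_zero_iff_of_nonneg hterm).1 hre i (Finset.mem_univ i)
    rw [ρ.integral_conj_matrixCoeff_mul_self μ, Complex.ofReal_re] at hi0
    have hint : Integrable (fun g => ‖ρ.matrixCoeff (φ i) x g‖ ^ 2) μ := (hL2 i x).norm.integrable_sq
    have hae := (integral_eq_zero_iff_of_nonneg (fun g => sq_nonneg _) hint).1 hi0
    refine hi (hae.mono fun g hg => ?_)
    have : ‖ρ.matrixCoeff (φ i) x g‖ ^ 2 = 0 := hg
    exact norm_eq_zero.1 (pow_eq_zero_iff two_ne_zero |>.1 this)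
  · -- invariant
    intro h x y
    refine Finset.sum_congr rfl fun i _ => ?_
    simp only [Representation.matrixCoeff_apply_right]
    exact integral_mul_right_eq_self (fun g => conj (ρ.matrixCoeff (φ i) x g) * ρ.matrixCoeff (φ i) y g) h

/-- **`L²` COEFFICIENTS ⇒ UNITARIZABLE** (★ `Representation.IsUnitarizable`: a `G`-invariant positive-definite Hermitian sesquilinear form, packaged as `LinearMap.mk₂'ₛₗ`).
[cite: Casselman1995, §2.5 Prop. 2.5.4 p. 29] [cite: Casselman1995, §2.5] -/
theorem _root_.Representation.isUnitarizable_of_memLp_matrixCoeff [μ.IsMulRightInvariant] {ι : Type*} [Fintype ι] (φ : ι → Module.Dual ℂ V)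
    (hL2 : ∀ (i : ι) (v : V), MemLp (ρ.matrixCoeff (φ i) v) 2 μ)
    (hsep : ∀ v : V, v ≠ 0 → ∃ i, ¬ (ρ.matrixCoeff (φ i) v =ᵐ[μ] 0)) : ρ.IsUnitarizable := by
  obtain ⟨ip, hadd, hsmul, hsymm, hnonneg, hdef, hinv⟩ := ρ.exists_invariant_form_of_memLp_matrixCoeff μ φ hL2 hsep
  have hadd' : ∀ x y z, ip x (y + z) = ip x y + ip x z := fun x y z => by
    rw [← hsymm x (y + z), hadd, map_add, hsymm, hsymm]
  have hsmul' : ∀ (c : ℂ) (x y : V), ip x (c • y) = c * ip x y := fun c x y => by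
    rw [← hsymm x (c • y), hsmul, map_mul, RingHomCompTriple.comp_apply, RingHom.id_apply, hsymm]
  refine ⟨LinearMap.mk₂'ₛₗ (starRingEnd ℂ) (RingHom.id ℂ) ip hadd (fun c x y => by rw [hsmul]; rfl) hadd' (fun c x y => by rw [hsmul']; rfl),
    ⟨fun x y => hsymm y x⟩, fun x hx => ?_, fun g x y => hinv g x y⟩
  · refine lt_of_le_of_ne (hnonneg x) fun h0 => hx (hdef x ?_)
    apply Complex.ext
    · simpa using h0.symm
    · have hreal : conj (ip x x) = ip x x := hsymm x x
      have := congrArg Complex.im hreal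
      simp only [Complex.conj_im] at this
      simp only [Complex.zero_im]
      linarith

end Form

/-! ## §2 Complete reducibility from `L²` coefficients -/

section Reducible

variable {G : Type*} [Group G] [TopologicalSpace G] [IsTopologicalGroup G] [MeasurableSpace G] [BorelSpace G]
  (μ : Measure G) [μ.IsMulRightInvariant] [μ.IsOpenPosMeasure] {V : Type*} [AddCommGroup V] [Module ℂ V] (ρ : Representation ℂ G V)

/-- **EVERY SUBREPRESENTATION IS COMPLEMENTED** when `ρ` is admissible, `G` has a compact open subgroup, and finitely many linear forms have `L²` coefficients separating the vectors
POINTWISE (`v ≠ 0 ⇒ φᵢ(ρ g v) ≠ 0` for some `i, g`) — ★ complete reducibility over the form of §1. [cite: BernsteinZelevinskyRMS1976, 2.44 p. 28] [cite: Casselman1995, Prop. 2.1.5] -/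
theorem _root_.Representation.exists_isCompl_of_memLp_matrixCoeff (hρ : ρ.IsAdmissible)
    (hK : ∃ K : Subgroup G, IsOpen (K : Set G) ∧ IsCompact (K : Set G)) {ι : Type*} [Fintype ι] (φ : ι → Module.Dual ℂ V)
    (hL2 : ∀ (i : ι) (v : V), MemLp (ρ.matrixCoeff (φ i) v) 2 μ)
    (hsep : ∀ v : V, v ≠ 0 → ∃ (i : ι) (g : G), φ i (ρ g v) ≠ 0) (W : Subrepresentation ρ) :
    ∃ W' : Subrepresentation ρ, IsCompl W.toSubmodule W'.toSubmodule := by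
  obtain ⟨ip, h1, h2, h3, h4, h5, h6⟩ := ρ.exists_invariant_form_of_memLp_matrixCoeff μ φ hL2 fun v hv => by
    obtain ⟨i, g, hg⟩ := hsep v hv
    exact ⟨i, ρ.not_matrixCoeff_ae_eq_zero μ hρ.isSmooth hg⟩
  exact exists_isCompl_subrepresentation_of_invariant_form ρ hρ hK ip h1 h2 h3 h4 h5 h6 W

end Reducible

/-! ## §3 Sections from invariant complements (pure algebra) -/

section Section

variable {k : Type*} [Field k] {G : Type*} [Monoid G] {S : Type*} [AddCommGroup S] [Module k S] {E : Type*} [AddCommGroup E] [Module k E]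
  {S' : Type*} [AddCommGroup S'] [Module k S']
  (σ : Representation k G S) (τ : Representation k G E) (σ' : Representation k G S')

/-- **AN INVARIANT COMPLEMENT OF `i.range = ker p` GIVES AN EQUIVARIANT SECTION OF `p`**: `p|_{W'} : W' → S` is a linear isomorphism (injective as `W' ⊓ ker p = ⊥`, surjective as
`p` is and `ker p ⊔ W' = ⊤`), its inverse followed by the inclusion is equivariant (`p` is injective on the invariant `W'`), and `p ∘ s = 1`.
[cite: BernsteinZelevinskyRMS1976, §2.1–§2.3] -/
theorem _root_.Representation.exists_section_of_isCompl_range (i : σ.IntertwiningMap τ) (p : τ.IntertwiningMap σ')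
    (hker : LinearMap.ker p.toLinearMap = LinearMap.range i.toLinearMap) (hp : Function.Surjective p)
    (W' : Subrepresentation τ) (hW' : IsCompl i.range.toSubmodule W'.toSubmodule) :
    ∃ s : σ'.IntertwiningMap τ, p.comp s = Representation.IntertwiningMap.id σ' := by
  have hrange : i.range.toSubmodule = LinearMap.ker p.toLinearMap := by rw [hker]; rfl
  set q : W'.toSubmodule →ₗ[k] S' := p.toLinearMap.domRestrict W'.toSubmodule with hq
  have hqinj : Function.Injective q := by
    intro a b hab
    have hmem : (a : E) - b ∈ LinearMap.ker p.toLinearMap := by rw [LinearMap.mem_ker, map_sub, sub_eq_zero]; exact hab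
    rw [← hrange] at hmem
    have hW : (a : E) - b ∈ W'.toSubmodule := W'.toSubmodule.sub_mem a.2 b.2
    have h0 : (a : E) - b = 0 := by simpa using hW'.disjoint.le_bot (Submodule.mem_inf.2 ⟨hmem, hW⟩)
    exact Subtype.ext (sub_eq_zero.1 h0)
  have hqsurj : Function.Surjective q := by
    intro y
    obtain ⟨e, rfl⟩ := hp y
    have htop : (e : E) ∈ i.range.toSubmodule ⊔ W'.toSubmodule := by rw [hW'.sup_eq_top]; exact Submodule.mem_top
    obtain ⟨a, ha, b, hb, hab⟩ := Submodule.mem_sup.1 htop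
    refine ⟨⟨b, hb⟩, ?_⟩
    rw [hrange, LinearMap.mem_ker] at ha
    show p b = p e
    have : p e = p a + p b := by rw [← hab, map_add]
    rw [this, show p a = 0 from ha, zero_add]
  let eqv : W'.toSubmodule ≃ₗ[k] S' := LinearEquiv.ofBijective q ⟨hqinj, hqsurj⟩
  have heqv : ∀ w : W'.toSubmodule, eqv w = p (w : E) := fun w => rfl
  have hequiv : ∀ (g : G) (y : S'), (eqv.symm (σ' g y) : E) = τ g (eqv.symm y : E) := by
    intro g y
    have hmem : τ g (eqv.symm y : E) ∈ W'.toSubmodule := W'.apply_mem_toSubmodule g (eqv.symm y).2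
    have h1 : eqv ⟨τ g (eqv.symm y : E), hmem⟩ = σ' g y := by
      rw [heqv]
      show p (τ g (eqv.symm y : E)) = σ' g y
      rw [p.isIntertwining, show p (eqv.symm y : E) = eqv (eqv.symm y) from (heqv _).symm, LinearEquiv.apply_symm_apply]
    rw [show eqv.symm (σ' g y) = ⟨τ g (eqv.symm y : E), hmem⟩ by rw [← h1, LinearEquiv.symm_apply_apply]]
  refine ⟨⟨W'.toSubmodule.subtype ∘ₗ eqv.symm.toLinearMap, fun g => ?_⟩, ?_⟩
  · refine LinearMap.ext fun y => ?_
    simp only [LinearMap.coe_comp, Function.comp_apply, LinearEquiv.coe_coe, Submodule.coe_subtype]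
    exact hequiv g y
  · refine Representation.IntertwiningMap.ext (LinearMap.ext fun y => ?_)
    show p ((eqv.symm y : W'.toSubmodule) : E) = y
    rw [← heqv, LinearEquiv.apply_symm_apply]

end Section

/-! ## §4 Self-extensions of an irreducible with `L²` coefficients split -/

section Split

variable {G : Type*} [Group G] [TopologicalSpace G] [IsTopologicalGroup G] [MeasurableSpace G] [BorelSpace G]
  (μ : Measure G) [μ.IsMulRightInvariant] [μ.IsOpenPosMeasure]
  {S : Type*} [AddCommGroup S] [Module ℂ S] (σ : Representation ℂ G S)
  {E : Type*} [AddCommGroup E] [Module ℂ E] (τ : Representation ℂ G E)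

/-- **SELF-EXTENSIONS (indeed all extensions `0 → σ → τ → σ' → 0` with `σ` irreducible) OF AN ADMISSIBLE `τ` WITH `L²` SMOOTH COEFFICIENTS SPLIT.**  `σ` irreducible, `τ`
admissible with every smooth coefficient `c_{φ,v}` (`φ ∈ τ̃`) in `L²(μ)` for a right-invariant `μ` charging open sets, `G` with a compact open subgroup, `i : σ → τ` injective,
`p : τ → σ'` surjective, `ker p = range i`: then `p` has an equivariant section.  (ONE smooth functional `l ∘ e_K` non-zero on `i(σ)`; the largest subrepresentation `N` in its
kernel meets `i(σ)` trivially; either `p(N) = ⊤` — `N` is an invariant complement of `ker p` — or `N = ⊥` and the one-coefficient family separates, so §2 gives a complement; §3.)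
In the cell: `hsplit` of ★ `F0P3cStCharTSEPNormOneUnr` at an `L²` class, modulo «self-extensions of `L²` irreducibles are `L²`» [Casselman1995 Thm. 4.4.6].
[cite: Casselman1995, §2.5 Prop. 2.5.3–2.5.4 p. 29] [cite: BernsteinZelevinskyRMS1976, 2.44 p. 28] [cite: BushnellHenniart2006, §10.1 p. 70; 10a.1–10a.2 pp. 73–75] [cite: Casselman1995, Prop. 2.1.5 and §2.5] -/
theorem _root_.Representation.selfExtension_splits_of_memLp_matrixCoeff [σ.IsIrreducible]
    {S' : Type*} [AddCommGroup S'] [Module ℂ S'] (σ' : Representation ℂ G S') [σ'.IsIrreducible]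
    (hτ : τ.IsAdmissible) (hK : ∃ K : Subgroup G, IsOpen (K : Set G) ∧ IsCompact (K : Set G))
    (hL2 : ∀ φ ∈ τ.contragredient, ∀ v : E, MemLp (τ.matrixCoeff φ v) 2 μ)
    (i : σ.IntertwiningMap τ) (p : τ.IntertwiningMap σ') (hi : Function.Injective i)
    (hker : LinearMap.ker p.toLinearMap = LinearMap.range i.toLinearMap) (hp : Function.Surjective p) :
    ∃ s : σ'.IntertwiningMap τ, p.comp s = Representation.IntertwiningMap.id σ' := by
  classical
  have hsmooth : τ.IsSmooth := hτ.isSmooth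
  have hrange : i.range.toSubmodule = LinearMap.ker p.toLinearMap := by rw [hker]; rfl
  obtain ⟨v₀, hv₀⟩ : ∃ v₀ : S, v₀ ≠ 0 := by
    by_contra h; push Not at h
    exact (IsSimpleOrder.bot_ne_top (α := Subrepresentation σ)) (Subrepresentation.toSubmodule_injective (by ext x; simp [h x]))
  have hiv₀ : i v₀ ≠ 0 := fun h0 => hv₀ (hi (by rw [h0, map_zero]))
  obtain ⟨K₀, hK₀o, hK₀c⟩ := hK
  set K : Subgroup G := K₀ ⊓ τ.stabilizerSubgroup (i v₀) with hKdef
  have hKo : IsOpen (K : Set G) := hK₀o.inter (hsmooth (i v₀))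
  have hKc : IsCompact (K : Set G) := hK₀c.of_isClosed_subset (K.isClosed_of_isOpen hKo) fun x hx => hx.1
  have hKfix : ∀ κ ∈ K, τ κ (i v₀) = i v₀ := fun κ hκ => (Representation.mem_stabilizerSubgroup τ _ κ).1 hκ.2
  obtain ⟨l, hl⟩ : ∃ l : Module.Dual ℂ E, l (i v₀) ≠ 0 := by
    by_contra h; push Not at h; exact hiv₀ ((Module.forall_dual_apply_eq_zero_iff ℂ (i v₀)).1 h)
  set φ : Module.Dual ℂ E := l.comp (τ.avgProjLinear K hsmooth hKc) with hφdef
  have hφmem : φ ∈ τ.contragredient := Representation.comp_avgProjLinear_mem_contragredient K hsmooth hKc hKo l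
  have hφv₀ : φ (i v₀) ≠ 0 := by
    rwa [hφdef, LinearMap.comp_apply, Representation.avgProjLinear_apply, Representation.avgProj_of_forall_apply_eq hKc hKo hKfix]
  let N : Subrepresentation τ :=
    { toSubmodule := ⨅ g : G, LinearMap.ker (φ ∘ₗ (τ g : E →ₗ[ℂ] E))
      apply_mem_toSubmodule := fun g v hv => by
        rw [Submodule.mem_iInf] at hv ⊢
        intro g'
        have := hv (g' * g)
        rw [LinearMap.mem_ker, LinearMap.comp_apply] at this ⊢
        rwa [map_mul, Module.End.mul_apply] at this }
  have hNmem : ∀ v : E, v ∈ N.toSubmodule ↔ ∀ g : G, φ (τ g v) = 0 := fun v => by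
    show v ∈ ⨅ g : G, LinearMap.ker (φ ∘ₗ (τ g : E →ₗ[ℂ] E)) ↔ _
    rw [Submodule.mem_iInf]
    exact forall_congr' fun g => Iff.rfl
  have hNi : ∀ x : S, i x ∈ N.toSubmodule → x = 0 := by
    let P : Subrepresentation σ :=
      { toSubmodule := N.toSubmodule.comap i.toLinearMap
        apply_mem_toSubmodule := fun g x hx => by
          rw [Submodule.mem_comap] at hx ⊢
          rw [Representation.IntertwiningMap.toLinearMap_apply, i.isIntertwining]
          exact N.apply_mem_toSubmodule g hx }
    rcases IsSimpleOrder.eq_bot_or_eq_top P with hP | hP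
    · intro x hx
      have : x ∈ P.toSubmodule := hx
      rw [hP] at this
      exact (Submodule.mem_bot ℂ).1 this
    · exfalso
      have hv : v₀ ∈ P.toSubmodule := by rw [hP]; exact Submodule.mem_top
      have : φ (τ 1 (i v₀)) = 0 := (hNmem _).1 hv 1
      rw [map_one, Module.End.one_apply] at this
      exact hφv₀ this
  let Q : Subrepresentation σ' :=
    { toSubmodule := N.toSubmodule.map p.toLinearMap
      apply_mem_toSubmodule := fun g y hy => by
        obtain ⟨n, hn, rfl⟩ := Submodule.mem_map.1 hy
        refine Submodule.mem_map.2 ⟨τ g n, N.apply_mem_toSubmodule g hn, ?_⟩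
        rw [Representation.IntertwiningMap.toLinearMap_apply, Representation.IntertwiningMap.toLinearMap_apply, p.isIntertwining] }
  rcases IsSimpleOrder.eq_bot_or_eq_top Q with hQ | hQ
  · -- `p(N) = 0`: `N ≤ ker p = range i`, so `N = 0` by `hNi`; the ONE family `{φ}` separates pointwise
    have hN0 : ∀ v ∈ N.toSubmodule, v = 0 := by
      intro v hv
      have hpv : p v = 0 := by
        have : p.toLinearMap v ∈ Q.toSubmodule := Submodule.mem_map_of_mem hv
        rw [hQ] at this
        exact (Submodule.mem_bot ℂ).1 this
      have hvker : v ∈ LinearMap.ker p.toLinearMap := hpv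
      rw [hker] at hvker
      obtain ⟨x, rfl⟩ := hvker
      rw [Representation.IntertwiningMap.toLinearMap_apply] at hv ⊢
      rw [hNi x hv, map_zero]
    have hsep : ∀ v : E, v ≠ 0 → ∃ (j : Unit) (g : G), (fun _ : Unit => φ) j (τ g v) ≠ 0 := by
      intro v hv
      by_contra h
      push Not at h
      exact hv (hN0 v ((hNmem v).2 fun g => h () g))
    obtain ⟨W', hW'⟩ := τ.exists_isCompl_of_memLp_matrixCoeff μ hτ ⟨K₀, hK₀o, hK₀c⟩ (fun _ : Unit => φ)
      (fun _ v => hL2 φ hφmem v) hsep i.range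
    exact Representation.exists_section_of_isCompl_range σ τ σ' i p hker hp W' hW'
  · -- `p(N) = ⊤`: `N` itself is an invariant complement of `range i = ker p`
    refine Representation.exists_section_of_isCompl_range σ τ σ' i p hker hp N ?_
    refine IsCompl.of_eq ?_ ?_
    · -- `range i ⊓ N = ⊥`
      refine (Submodule.eq_bot_iff _).2 fun v hv => ?_
      obtain ⟨hv1, hv2⟩ := Submodule.mem_inf.1 hv
      have hv1' : v ∈ LinearMap.range i.toLinearMap := hv1
      obtain ⟨x, rfl⟩ := LinearMap.mem_range.1 hv1'
      rw [Representation.IntertwiningMap.toLinearMap_apply] at hv2 ⊢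
      rw [hNi x hv2, map_zero]
    · -- `range i ⊔ N = ⊤`: `p e = p n` for some `n ∈ N`, so `e - n ∈ ker p = range i`
      refine Submodule.eq_top_iff'.2 fun e => ?_
      have hpe : p.toLinearMap e ∈ Q.toSubmodule := by rw [hQ]; exact Submodule.mem_top
      obtain ⟨n, hn, hpn⟩ := Submodule.mem_map.1 hpe
      have hdiff : e - n ∈ LinearMap.ker p.toLinearMap := by
        rw [LinearMap.mem_ker, map_sub, hpn, sub_self]
      rw [hker] at hdiff
      have : e = (e - n) + n := by abel
      rw [this]
      exact Submodule.add_mem_sup (by exact hdiff) hn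

end Split

end Literature.NumberTheory.Automorphic

end
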